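import Literature.AnabelianGeometry.EtaleTheta.CyclotomeTowerAllLevels
import Mathlib.CategoryTheory.CofilteredSystem
import Mathlib.Data.Nat.Factorial.Basic
import HarnessLib

/-!
# [EtTh] §2 over §1: a compatible TOWER of cyclotome identifications `μ_M ≅ (l·Δ_Θ) ⊗ ℤ/Mℤ` exists as soon
# as an identification exists at EVERY level separately (Kőnig) — the coherence half of GAP-LEDGER row
# G-L2t10-1 is automatic

Mochizuki, *The étale theta function …*, Publ. RIMS **45** (2009), §2: Def. 2.10 p. 44 («`μ_N`»), §2 p. 46
(«the natural isomorphism `μ_N ≅ (l·Δ_Θ) ⊗ (ℤ/Nℤ)`»), Def. 2.13 (ii) p. 48 («`M_{N'}` … induced by `M`»),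
Cor. 2.19 (ii) PRIMS PDF p. 64 («Let `E ⊆ ℕ≥1` be a cofinal, totally ordered subset … such that `1 ∈ E` … we obtain
a natural projective system») [cite: MochizukiEtTh2009, Cor 2.19 (ii) p.64]; §1 p. 12 «`(Ẑ(1) ≅) Δ_Θ`»
[cite: MochizukiEtTh2009, §1 p.12].  Layer L2 vocabulary of the abc-iut cell: abc-iut-L2-t8's `ThetaSetting.CyclotomeMod l N`
(`ThetaCyclotomes.lean`) and abc-iut-L2-t10's `ThetaSetting.CyclotomeTower l E` (`TowerOfSetting.lean`); seat
abc-iut-w5-d187 (gen 3).  PROOF-ONLY: every declaration below is a theorem; nothing of another seat's file is edited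
or restated.

THE POINT (GAP-LEDGER row **G-L2t10-1**, «DATUM wanted: `Nonempty (D.CyclotomeTower l E)` for some cofinal chain
`E ∋ 1` — equivalently a compatible family `mods : ∀ M : ℕ+, D.CyclotomeMod l M` with `hmods`»).  The datum has two
halves: EXISTENCE of a `G_K`-equivariant identification `(l·Δ_Θ)/M ≅ μ_M` at each level, and COHERENCE of the chosen
identifications under the power maps `μ_{M'} ↠ μ_M`.  This file proves that the coherence half is FREE:

* `CyclotomeMod.exists_of_dvd` / `nonempty_of_dvd` — an identification at level `M'` restricts to one at every level
  `M ∣ M'` (`(l·Δ_Θ) ↠ μ_{M'} ↠ μ_M`; kernel computed with `MuN.red_eq_one_iff` and the commutativity of `Δ_Θ`);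
* `CyclotomeMod.ext_red` — an identification is determined by its surjection `red`;
* `CyclotomeMod.finite` — at each level there are only FINITELY many identifications (each is determined by its
  values on a section of a fixed one: they all have the same kernel, the `M`-th powers);
* `CyclotomeMod.exists_compatible_family_of_forall_nonempty` — **if an identification exists at every level, then a
  COMPATIBLE family at all levels exists** (the identifications at the levels `k!` form an inverse system of nonempty
  finite sets, which has a thread by Kőnig's lemma, Mathlib `nonempty_sections_of_finite_inverse_system`; restrict the
  thread from `M!` to `M`);
* `nonempty_cyclotomeTower_iff_forall_nonempty` — for every cofinal chain `E ∋ 1`: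
  `Nonempty (D.CyclotomeTower l E) ↔ ∀ N, Nonempty (D.CyclotomeMod l N)`; and it suffices to have identifications at
  a cofinal set of levels (`forall_nonempty_of_cofinal`).

CONSEQUENCE for the root-clause bookkeeping (L2-lead's R78 sizing; numbers, not opinions): G-L2t10-1 is EQUIVALENT to
the levelwise statement «`∀ N, Nonempty (D.CyclotomeMod l N)`» (indeed to its restriction to any cofinal set of
levels, e.g. prime powers or factorials); no compatibility field is needed in a root repair.  Nothing of [EtTh] is
asserted; no side is taken on [IUTchIII] Cor. 3.12; typed ≠ proved (here: proved, elementary).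
-/

noncomputable section

namespace Literature.AnabelianGeometry.EtaleTheta

open CategoryTheory Literature.AnabelianGeometry.SemiGraphs

namespace ThetaSetting

variable {p : ℕ} [Fact p.Prime] {D : ThetaSetting p} {l : ℕ}

namespace CyclotomeMod

/-! ### An identification is determined by its surjection; restriction to a divisor level -/

/-- Two cyclotome identifications at the same level with the same surjection `(l·Δ_Θ) ↠ μ_N` are equal (the other
fields are propositions). [cite: MochizukiEtTh2009, Def 2.10 p.44] -/
theorem ext_red {N : ℕ+} {μ μ' : D.CyclotomeMod l N} (h : ∀ x, μ.red x = μ'.red x) : μ = μ' := by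
  obtain ⟨r, _, _, _, _⟩ := μ
  obtain ⟨r', _, _, _, _⟩ := μ'
  have hr : r = r' := MonoidHom.ext h
  subst hr
  rfl

/-- **Restriction to a divisor level** («`M_{N'}` … induced by `M`», Def. 2.13 (ii)): an identification
`μ_{M'} ≅ (l·Δ_Θ) ⊗ ℤ/M'ℤ` yields one at every level `M ∣ M'`, namely `(l·Δ_Θ) ↠ μ_{M'} ↠ μ_M` — onto, with kernel
the `M`-th powers (in the cyclic group `μ_{M'}` the kernel of `ζ ↦ ζ^{M'/M}` is the subgroup of `M`-th powers;
`Δ_Θ` is commutative), continuous, `G_K`-equivariant. [cite: MochizukiEtTh2009, Def 2.13 (ii) p.48] -/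
theorem exists_of_dvd {M M' : ℕ+} (h : (M : ℕ) ∣ M') (μ' : D.CyclotomeMod l M') :
    ∃ μ : D.CyclotomeMod l M, ∀ x, μ.red x = MuN.red p M M' h (μ'.red x) := by
  refine ⟨{ red := (MuN.red p M M' h).comp μ'.red
            red_surjective := (MuN.red_surjective p M M' h).comp μ'.red_surjective
            red_ker := fun x => ?_
            continuous_red :=
              (continuous_of_discreteTopology (f := ⇑(MuN.red p M M' h))).comp μ'.continuous_red
            red_conj := fun σ x => ?_ }, fun x => rfl⟩
  · constructor
    · intro hx
      rw [MonoidHom.comp_apply, MuN.red_eq_one_iff] at hx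
      obtain ⟨ξ, hξ⟩ := hx
      obtain ⟨y₀, hy₀⟩ := μ'.red_surjective ξ
      -- `red_{M'} (x * (y₀^M)⁻¹) = 1`, so `x * (y₀^M)⁻¹` is an `M'`-th power
      have h1 : μ'.red (x * (y₀ ^ (M : ℕ))⁻¹) = 1 := by
        rw [map_mul, map_inv, map_pow, hy₀, ← hξ, mul_inv_cancel]
      obtain ⟨z, hz⟩ := (μ'.red_ker _).1 h1
      obtain ⟨q, hq⟩ := h
      refine ⟨z ^ q * y₀, ?_⟩
      have hcomm : Commute (z ^ q) y₀ := CyclotomeTower.lDeltaTheta_commute _ _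
      rw [hcomm.mul_pow, ← pow_mul, mul_comm q, ← hq, ← hz, inv_mul_cancel_right]
    · rintro ⟨y, rfl⟩
      rw [MonoidHom.comp_apply, map_pow]
      exact MuN.red_pow_card p M M' h _
  · show MuN.red p M M' h (μ'.red _) = galMuN p M (D.aug.toMonoidHom σ) (MuN.red p M M' h (μ'.red x))
    rw [μ'.red_conj, MuN.red_gal]

/-- An identification at level `M'` gives one at every level `M ∣ M'`. [cite: MochizukiEtTh2009, Def 2.13 (ii) p.48] -/
theorem nonempty_of_dvd {M M' : ℕ+} (h : (M : ℕ) ∣ M') :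
    Nonempty (D.CyclotomeMod l M') → Nonempty (D.CyclotomeMod l M) := by
  rintro ⟨μ'⟩
  obtain ⟨μ, -⟩ := exists_of_dvd h μ'
  exact ⟨μ⟩

/-- Identifications at a COFINAL set of levels give identifications at all levels.
[cite: MochizukiEtTh2009, Cor 2.19 (ii) p.64] -/
theorem forall_nonempty_of_cofinal (h : ∀ N : ℕ+, ∃ M : ℕ+, (N : ℕ) ∣ M ∧ Nonempty (D.CyclotomeMod l M))
    (N : ℕ+) : Nonempty (D.CyclotomeMod l N) := by
  obtain ⟨M, hNM, hM⟩ := h N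
  exact nonempty_of_dvd hNM hM

/-! ### Finiteness of the set of identifications at one level -/

/-- **At each level there are only finitely many cyclotome identifications**: all of them have the same kernel (the
`N`-th powers), so each is determined by its values on a section of a fixed one — a map from the finite set `μ_N`
to itself. [cite: MochizukiEtTh2009, Def 2.10 p.44] -/
theorem finite (N : ℕ+) : Finite (D.CyclotomeMod l N) := by
  rcases isEmpty_or_nonempty (D.CyclotomeMod l N) with hE | hne
  · infer_instance
  · obtain ⟨μ₀⟩ := hne
    have hsurj := μ₀.red_surjective
    choose s hs using hsurj
    refine Finite.of_injective (fun μ : D.CyclotomeMod l N => fun ζ : MuN p N => μ.red (s ζ)) ?_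
    intro μ μ' hμ
    apply ext_red
    intro x
    -- `x = s (red₀ x) · y^N` with `red₀ (y^N) = 1`
    have hk : μ₀.red ((s (μ₀.red x))⁻¹ * x) = 1 := by
      rw [map_mul, map_inv, hs, inv_mul_cancel]
    obtain ⟨y, hy⟩ := (μ₀.red_ker _).1 hk
    have hx : x = s (μ₀.red x) * y ^ (N : ℕ) := by
      rw [← hy, mul_inv_cancel_left]
    have h1 : μ.red (y ^ (N : ℕ)) = 1 := (μ.red_ker _).2 ⟨y, rfl⟩
    have h2 : μ'.red (y ^ (N : ℕ)) = 1 := (μ'.red_ker _).2 ⟨y, rfl⟩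
    have h3 : μ.red (s (μ₀.red x)) = μ'.red (s (μ₀.red x)) := congrFun hμ (μ₀.red x)
    rw [hx, map_mul, map_mul, h1, h2, mul_one, mul_one, h3]

/-! ### Kőnig: a compatible family at all levels from identifications at every level -/

/-- Exponent bookkeeping: divisibility of factorials along `k ≤ m`, in `ℕ≥1`. [folklore] -/
private theorem factorial_dvd {k m : ℕ} (hkm : k ≤ m) :
    (((⟨k.factorial, Nat.factorial_pos k⟩ : ℕ+) : ℕ)) ∣ ((⟨m.factorial, Nat.factorial_pos m⟩ : ℕ+) : ℕ) :=
  Nat.factorial_dvd_factorial hkm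

/-- **Coherence is free.** If a cyclotome identification `μ_N ≅ (l·Δ_Θ) ⊗ ℤ/Nℤ` exists at EVERY level `N`, then there
is a family of identifications at all levels COMPATIBLE with every power map `μ_{M'} ↠ μ_M`, `M ∣ M'`: the
identifications at the levels `k!` form an inverse system of nonempty FINITE sets under restriction, which has a thread
by Kőnig's lemma (Mathlib `nonempty_sections_of_finite_inverse_system`); the identification at `M` is the restriction
of the thread's level `M!`. [cite: MochizukiEtTh2009, Cor 2.19 (ii) p.64] -/
theorem exists_compatible_family_of_forall_nonempty (h : ∀ N : ℕ+, Nonempty (D.CyclotomeMod l N)) :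
    ∃ mods : ∀ M : ℕ+, D.CyclotomeMod l M,
      ∀ (M M' : ℕ+) (hd : (M : ℕ) ∣ (M' : ℕ)) (x : D.lDeltaTheta l),
        MuN.red p M M' hd ((mods M').red x) = (mods M).red x := by
  classical
  -- the levels `k!` and the restriction maps between them
  let lev : ℕ → ℕ+ := fun k => ⟨k.factorial, Nat.factorial_pos k⟩
  let R : ∀ {k m : ℕ}, k ≤ m → D.CyclotomeMod l (lev m) → D.CyclotomeMod l (lev k) :=
    fun hkm μ' => Classical.choose (exists_of_dvd (factorial_dvd hkm) μ')
  have hR : ∀ {k m : ℕ} (hkm : k ≤ m) (μ' : D.CyclotomeMod l (lev m)) (x : D.lDeltaTheta l),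
      (R hkm μ').red x = MuN.red p (lev k) (lev m) (factorial_dvd hkm) (μ'.red x) :=
    fun hkm μ' => Classical.choose_spec (exists_of_dvd (factorial_dvd hkm) μ')
  -- the inverse system `k ↦ CyclotomeMod l k!`
  let F : ℕᵒᵖ ⥤ Type := {
    obj := fun k => D.CyclotomeMod l (lev (Opposite.unop k))
    map := fun {m k} f => TypeCat.ofHom fun μ' => R f.unop.le μ'
    map_id := fun k => ConcreteCategory.hom_ext _ _ fun μ' => by
      apply ext_red
      intro x
      change (R le_rfl μ').red x = μ'.red x
      rw [hR le_rfl, MuN.red_self]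
    map_comp := fun {m k j} f g => ConcreteCategory.hom_ext _ _ fun μ' => by
      apply ext_red
      intro x
      change (R (g.unop.le.trans f.unop.le) μ').red x = (R g.unop.le (R f.unop.le μ')).red x
      rw [hR (g.unop.le.trans f.unop.le), hR g.unop.le, hR f.unop.le, ← MuN.red_comp] }
  haveI : ∀ k : ℕᵒᵖ, Finite (F.obj k) := fun k => finite (lev (Opposite.unop k))
  haveI : ∀ k : ℕᵒᵖ, Nonempty (F.obj k) := fun k => h (lev (Opposite.unop k))
  obtain ⟨s, hs⟩ := nonempty_sections_of_finite_inverse_system F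
  -- the thread: `s k` at level `k!`, with `R (k ≤ m) (s m) = s k`
  have hthread : ∀ {k m : ℕ} (hkm : k ≤ m) (x : D.lDeltaTheta l),
      (s (Opposite.op k)).red x =
        MuN.red p (lev k) (lev m) (factorial_dvd hkm) ((s (Opposite.op m)).red x) := by
    intro k m hkm x
    have e : R hkm (s (Opposite.op m)) = s (Opposite.op k) := hs (homOfLE hkm).op
    rw [← e, hR hkm]
  -- restrict the level `M!` of the thread to `M`
  have hMfac : ∀ M : ℕ+, (M : ℕ) ∣ ((lev (M : ℕ) : ℕ+) : ℕ) := fun M => Nat.dvd_factorial M.pos le_rfl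
  refine ⟨fun M => Classical.choose (exists_of_dvd (hMfac M) (s (Opposite.op (M : ℕ)))), ?_⟩
  intro M M' hd x
  have hM := Classical.choose_spec (exists_of_dvd (hMfac M) (s (Opposite.op (M : ℕ)))) x
  have hM' := Classical.choose_spec (exists_of_dvd (hMfac M') (s (Opposite.op (M' : ℕ)))) x
  rw [hM, hM']
  have hle : (M : ℕ) ≤ (M' : ℕ) := Nat.le_of_dvd M'.pos hd
  rw [hthread hle x, ← MuN.red_comp, ← MuN.red_comp]

end CyclotomeMod

/-! ### The tower -/

/-- **A cyclotome tower over ANY cofinal chain `E ∋ 1` from identifications at every level** (Kőnig + re-chaining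
through abc-iut-L2's `CyclotomeTower.ofAllLevels`). [cite: MochizukiEtTh2009, Cor 2.19 (ii) p.64] -/
theorem nonempty_cyclotomeTower_of_forall_nonempty (h : ∀ N : ℕ+, Nonempty (D.CyclotomeMod l N))
    {E : Set ℕ+} (one_mem : (1 : ℕ+) ∈ E) (cofinal : ∀ n : ℕ+, ∃ M ∈ E, n ∣ M)
    (total : ∀ M ∈ E, ∀ M' ∈ E, M ∣ M' ∨ M' ∣ M) : Nonempty (D.CyclotomeTower l E) := by
  obtain ⟨mods, hmods⟩ := CyclotomeMod.exists_compatible_family_of_forall_nonempty h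
  exact ⟨CyclotomeTower.ofAllLevels mods hmods one_mem cofinal total⟩

/-- Conversely a tower over a cofinal chain gives identifications at every level (abc-iut-L2's `CyclotomeTower.modAll`).
[cite: MochizukiEtTh2009, Cor 2.19 (ii) p.64] -/
theorem forall_nonempty_of_cyclotomeTower {E : Set ℕ+} (τ : D.CyclotomeTower l E) (N : ℕ+) :
    Nonempty (D.CyclotomeMod l N) :=
  ⟨τ.modAll N⟩

/-- **G-L2t10-1 ⟺ levelwise existence.** For every cofinal chain `E ∋ 1` of `(ℕ≥1, ∣)`: a compatible cyclotome tower
over `E` exists iff a cyclotome identification exists at every level. [cite: MochizukiEtTh2009, Cor 2.19 (ii) p.64] -/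
theorem nonempty_cyclotomeTower_iff_forall_nonempty {E : Set ℕ+} (one_mem : (1 : ℕ+) ∈ E)
    (cofinal : ∀ n : ℕ+, ∃ M ∈ E, n ∣ M) (total : ∀ M ∈ E, ∀ M' ∈ E, M ∣ M' ∨ M' ∣ M) :
    Nonempty (D.CyclotomeTower l E) ↔ ∀ N : ℕ+, Nonempty (D.CyclotomeMod l N) :=
  ⟨fun ⟨τ⟩ => forall_nonempty_of_cyclotomeTower τ,
    fun h => nonempty_cyclotomeTower_of_forall_nonempty h one_mem cofinal total⟩

/-- The same with a COFINAL set of levels on the right (e.g. prime powers, or factorials): a tower over `E` exists iff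
identifications exist at cofinally many levels. [cite: MochizukiEtTh2009, Cor 2.19 (ii) p.64] -/
theorem nonempty_cyclotomeTower_iff_cofinal_nonempty {E : Set ℕ+} (one_mem : (1 : ℕ+) ∈ E)
    (cofinal : ∀ n : ℕ+, ∃ M ∈ E, n ∣ M) (total : ∀ M ∈ E, ∀ M' ∈ E, M ∣ M' ∨ M' ∣ M) :
    Nonempty (D.CyclotomeTower l E) ↔
      ∀ N : ℕ+, ∃ M : ℕ+, (N : ℕ) ∣ M ∧ Nonempty (D.CyclotomeMod l M) := by
  rw [nonempty_cyclotomeTower_iff_forall_nonempty one_mem cofinal total]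
  exact ⟨fun h N => ⟨N, dvd_refl _, h N⟩, fun h N => CyclotomeMod.forall_nonempty_of_cofinal h N⟩

/-- Transfer between chains: a tower over one cofinal chain `E ∋ 1` yields a tower over any other (re-chaining; recorded
here as the `Nonempty` statement). [cite: MochizukiEtTh2009, Cor 2.19 (ii) p.64] -/
theorem nonempty_cyclotomeTower_of_nonempty {E E' : Set ℕ+} (one_mem : (1 : ℕ+) ∈ E')
    (cofinal : ∀ n : ℕ+, ∃ M ∈ E', n ∣ M) (total : ∀ M ∈ E', ∀ M' ∈ E', M ∣ M' ∨ M' ∣ M) :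
    Nonempty (D.CyclotomeTower l E) → Nonempty (D.CyclotomeTower l E') := by
  rintro ⟨τ⟩
  exact ⟨τ.rechain one_mem cofinal total⟩

end ThetaSetting

end Literature.AnabelianGeometry.EtaleTheta

end
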